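import Summits.QuantumFields.YangMills.Theorems.FluctuationComparisonRegPrIntLOrganTangentFibredChartCompose
import Literature.MathematicalPhysics.QuantumFieldTheory.Balaban1983to89.T3DescentFibreTower
import Literature.MathematicalPhysics.QuantumFieldTheory.Balaban1983to89.T3OneStepAveragingPlaquettes
import HarnessLib

/-!
# `FluctuationComparisonRegPrIntLOrganTangentFibredChartDescendTo` — (L15-MW) THE m-STEP FIBRED CHART OF `descendTo F ℰp j (j+m+1)` FROM A HEIGHT, AS DATA, with fine set
# and (C3) mass on the MULTI-LEVEL («history-good») window — uniformly in `m` from ONE height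

Cell `ym3-torus` (rung R3 = continuum `SU(2)` Yang–Mills on T³ — NOT d = 4, NOT infinite volume, NOT a mass gap, NOT Clay), width seat `ym-ust-20520-w5` (gen 22),
pen (L15-MW) (CLAIM 2026-08-30 23:14Z; LEAD-20520 w3 g24 first refusal).  `--kind proof --supports stmt-QuantumFields-20520 --as helper`, count-neutral, definition-free,
default heartbeats; THEOREMS ONLY; nothing printed is asserted.

WHY (FINDING `ym-ust-20520-w5/g22/FINDING-w5g22-composite-chart-depth.v2.md`, 20520 evidence #46).  Composites of the landed one-step charts (✓`hmap_comp`) cover the TOP-LEVEL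
window of `G_{j+m}` with their fine set only to depth `m ≲ j∕3 + log_L(1∕γ)∕3` (the one-bond letters `hΩS` of ✓(L7) are smallness-driven with a height-independent radius, while
averaging inflates plaquettes by `≥ L²` per step — lit ✓`plaqSmall_descendTo_succ`).  The cap disappears if the support is the MULTI-LEVEL window
`MW_{j,m} = {U | every intermediate average descendTo (j+i+1) (j+m+1) U is 24∕25·θ_{j+i+1}-small}` (the `histGood` tube of ✓`mem_histGood_iff_descendTo` at the 24∕25 cut,
[Balaban1985UV3] (7) p.257): then each intermediate field is in the one-step fine set by the LANDED `hΩS` at exactly its landed radius, and (C3) on `MW` propagates by Tonelli.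
This file proves exactly that, uniformly in `m`, from the single height `jA` of ✓`exists_height_fibredChart`.

§1 small tools: `descend_eq_descendTo'` (one descent step is `D_{K,K+1}`, lit ✓`descendTo_succ`), `lintegral_pos_of_support_subset` (positivity transfer along supports).
§2 ★★★ `exists_height_fibredChart_descendTo` — for every `F : T3Family`, `0 < γ ≤ 1`, `0 < b₀`, `0 < p₀`: `∃ jA, ∀ j ≥ jA, ∀ K ≥ j+1, ∃ (Z, τ) probability space, Φ : G_j × Z → G_K,
J ≥ 0, S ⊆ G_K, B` with: measurability; `MW_{j,K} ⊆ S` (`MW_{j,K} := {U | ∀ n ∈ [j+1, K], PlaqSmall (24∕25·θ_n) (descendTo F ℰp n K U)}`); `descendTo F ℰp j K (Φ (V, z)) = V`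
for ALL `V, z`; the chart identity `dU_K⌊(descendTo⁻¹ A ∩ S) = Φ_*((dU_j⌊A ⊗ τ) · J)` over EVERY measurable base set `A`; (C1′) for every `MW_{j,K}`-supported
continuous test function and EVERY fibre point `z`, `V ↦ J (V,z)·f (Φ (V,z))` is continuous on the `θ_j`-window; `J ≤ B`; and (C3) for every `θ_j`-window datum `V`
the `J (V, ·)`-weighted `τ`-mass of `{z | Φ (V, z) ∈ MW_{j,K}}` is positive.  Induction on `K` from `j+1` (`D_{j,K+1} = D_{j,K} ∘ descend_K`, lit ✓`descendTo_descendTo`):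
base = ✓`exists_height_fibredChart` at `j`; step = IH ⊕ ✓`exists_height_fibredChart` at `K` through ✓`hmap_comp`, the descent algebra, `jacobian_comp_le`, (C1′) by feeding
the IH the level-`K` test function `y ↦ J₂ (y,U)·f (Φ₂ (y,U))` (continuous: one-step (C1′) on the `θ_K`-window ⊇ closure of its support; `MW_{j,K}`-supported by havgΦ₂),
and Tonelli for (C3) (the iterated small lift, in integrated form: `mass_{K+1}(V) ≥ ∫_{z ∈ MW-slice} J (V,z)·mass¹_K(Φ (V,z)) dτ > 0`).
NOT HERE: (A1)–(A3) for `descendTo` (the m-step BRIDGE is LEAD's re-key after v18; its test functions are supported in `MW`, per the FINDING and LEAD w3 g24 WORD №2).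
[cite: Balaban1987RG1, (0.4) p.253, (0.11) p.253, (2.4) p.266 and (2.10) p.267; Balaban1985Averaging, (10)-(13) p.19; Balaban1985UV3, (7) p.257]

HONEST: measure-theoretic plumbing + compositions of landed kernel facts; nothing of Bałaban's RG estimates is asserted or proved; O1 ∕ O1ᵘ-H ∕ LIN∘ ∕ JVAR∘ ∕ UNIQ-MAX∘ ∕
crux 20520 `FluctuationComparisonRegPrIntL` ∕ `YM3TorusSU2` NOT proved; registry `Lines/semiclassical_s2beta.lean` v11.4 (★★OWNER RULING №36) untouched; rung R3 = SU(2) YM₃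
on T³ — NOT d = 4, NOT infinite volume, NOT a mass gap, NOT Clay; the Yang–Mills mass gap is NOT proved by any of this.
-/

set_option autoImplicit false

noncomputable section

namespace Summit.QuantumFields.YangMills.Theorems.FluctuationComparisonRegPrIntLOrganTangentFibredChartDescendTo

open MeasureTheory ProbabilityTheory Filter Topology Set Function
open scoped ENNReal NNReal
open Literature.MathematicalPhysics.QuantumFieldTheory.Balaban1983to89
open T3ContinuumYM3Torus T3NestedUnitLaws T3UnitLawDensityEML T3UnitScaleTilt T3LevelShift T3TiltDescent
open Literature.MathematicalPhysics.QuantumFieldTheory.Balaban1983to89.T3OrbitAverage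
open Literature.MathematicalPhysics.QuantumFieldTheory.Balaban1983to89.T3DescentFibreTower (descendTo_descendTo descendTo_self)
open Literature.MathematicalPhysics.QuantumFieldTheory.Balaban1983to89.BlockAveragingHaarAC (centralBond)
open Summit.QuantumFields.YangMills.Theorems.OrganTangentFibreMeanTools
open Summit.QuantumFields.YangMills.Theorems.FluctuationComparisonRegPrIntLOrganTangentFibredChartFromHeight (exists_height_fibredChart)
open Summit.QuantumFields.YangMills.Theorems.FluctuationComparisonRegPrIntLOrganTangentFibredChartCompose
  (hmap_comp jacobian_comp_le measurable_comp_chart measurable_comp_jacobian)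

/-! ## §1 Small tools -/

/-- One descent step IS `D_{K,K+1}` (lit ✓`T3OneStepAveragingPlaquettes.descendTo_succ`; the two `fieldShift` proofs are irrelevant), with an arbitrary proof of `K ≤ K+1`.
[cite: Balaban1987RG1, (0.11) p.253] -/
theorem descend_eq_descendTo' (F : T3Family) (K : ℕ) (h : K ≤ K + 1) (U : GaugeField (F.P (K + 1)) 0 ↥(Matrix.specialUnitaryGroup (Fin 2) ℂ)) :
    descend F ℰp K U = descendTo F ℰp K (K + 1) h U := by
  rw [T3OneStepAveragingPlaquettes.descendTo_succ]
  rfl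

/-- Positivity transfer: if `∫⁻ f > 0` and `g` is non-zero wherever `f` is, then `∫⁻ g > 0` (both measurable). [folklore] -/
theorem lintegral_pos_of_support_subset {α : Type*} [MeasurableSpace α] {μ : Measure α} {f g : α → ℝ≥0∞}
    (hf : Measurable f) (hg : Measurable g) (hfg : ∀ x, f x ≠ 0 → g x ≠ 0) (hpos : 0 < ∫⁻ x, f x ∂μ) : 0 < ∫⁻ x, g x ∂μ := by
  rw [lintegral_pos_iff_support hf] at hpos
  rw [lintegral_pos_iff_support hg]
  exact hpos.trans_le (measure_mono fun x hx => Function.mem_support.2 (hfg x (Function.mem_support.1 hx)))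

/-! ## §2 The multi-step chart of `descendTo`, AS DATA, on the multi-level window -/

/-- ★★★ **THE MULTI-STEP FIBRED CHART OF `descendTo F ℰp j K` (`j + 1 ≤ K`) FROM A HEIGHT, AS DATA, ON THE MULTI-LEVEL WINDOW** (see the module docstring):
uniformly in `K` from the one height `jA` of ✓`exists_height_fibredChart`, by induction over ✓`hmap_comp`; the fibre `(Z, τ)` is an abstract probability space
(the product of the intermediate product-Haar spaces); the multi-level window is «every level `n ∈ [j+1, K]` of the history `descendTo n K U` is `24∕25·θ_n`-small».
[cite: Balaban1987RG1, (0.4) p.253, (0.11) p.253 and (2.10) p.267; Balaban1985Averaging, (10)-(13) p.19; Balaban1985UV3, (7) p.257] -/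
theorem exists_height_fibredChart_descendTo
    (F : T3Family) (γ b₀ p₀ : ℝ) (hγ : 0 < γ) (hγ1 : γ ≤ 1) (hb₀ : 0 < b₀) (hp₀ : 0 < p₀) :
    ∃ jA : ℕ, ∀ (j : ℕ), jA ≤ j → ∀ (K : ℕ) (hjK : j + 1 ≤ K),
      ∃ (Z : Type) (_ : MeasurableSpace Z) (τ : Measure Z)
        (Φ : GaugeField (F.P j) 0 ↥(Matrix.specialUnitaryGroup (Fin 2) ℂ) × Z → GaugeField (F.P K) 0 ↥(Matrix.specialUnitaryGroup (Fin 2) ℂ))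
        (J : GaugeField (F.P j) 0 ↥(Matrix.specialUnitaryGroup (Fin 2) ℂ) × Z → ℝ≥0)
        (S : Set (GaugeField (F.P K) 0 ↥(Matrix.specialUnitaryGroup (Fin 2) ℂ))) (B : ℝ),
        IsProbabilityMeasure τ ∧ Measurable Φ ∧ Measurable J ∧ MeasurableSet S ∧
        -- the multi-level window lies in the fine set
        (∀ U : GaugeField (F.P K) 0 ↥(Matrix.specialUnitaryGroup (Fin 2) ℂ),
          (∀ (n : ℕ) (hjn : j + 1 ≤ n) (hnK : n ≤ K), PlaqSmall (24 / 25 * θBal F.L γ b₀ p₀ n) (descendTo F ℰp n K hnK U)) → U ∈ S) ∧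
        -- havgΦ (everywhere)
        (∀ V z, descendTo F ℰp j K (Nat.le_of_succ_le hjK) (Φ (V, z)) = V) ∧
        -- hmap (every measurable base set)
        (∀ A : Set (GaugeField (F.P j) 0 ↥(Matrix.specialUnitaryGroup (Fin 2) ℂ)), MeasurableSet A →
          (fieldMeasure (F.P K) 0 ↥(Matrix.specialUnitaryGroup (Fin 2) ℂ)).restrict (descendTo F ℰp j K (Nat.le_of_succ_le hjK) ⁻¹' A ∩ S) =
            ((((fieldMeasure (F.P j) 0 ↥(Matrix.specialUnitaryGroup (Fin 2) ℂ)).restrict A).prod τ).withDensity (fun p => (J p : ℝ≥0∞))).map Φ) ∧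
        -- (C1′) on the multi-level window, for every fibre point
        (∀ f : GaugeField (F.P K) 0 ↥(Matrix.specialUnitaryGroup (Fin 2) ℂ) → ℝ, Continuous f →
          (∀ U, f U ≠ 0 → ∀ (n : ℕ) (hjn : j + 1 ≤ n) (hnK : n ≤ K), PlaqSmall (24 / 25 * θBal F.L γ b₀ p₀ n) (descendTo F ℰp n K hnK U)) →
          ∀ z, ContinuousOn (fun V => (J (V, z) : ℝ) * f (Φ (V, z))) {V | PlaqSmall (θBal F.L γ b₀ p₀ j) V}) ∧
        -- (C2)
        (∀ V z, (J (V, z) : ℝ) ≤ B) ∧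
        -- (C3) on the multi-level window
        (∀ V, PlaqSmall (θBal F.L γ b₀ p₀ j) V →
          0 < ∫⁻ z in {z | ∀ (n : ℕ) (hjn : j + 1 ≤ n) (hnK : n ≤ K), PlaqSmall (24 / 25 * θBal F.L γ b₀ p₀ n)
              (descendTo F ℰp n K hnK (Φ (V, z)))}, (J (V, z) : ℝ≥0∞) ∂τ) := by
  classical
  obtain ⟨jA, hjA⟩ := exists_height_fibredChart F γ b₀ p₀ hγ hγ1 hb₀ hp₀
  refine ⟨jA, fun j hj K hjK => ?_⟩
  induction K, hjK using Nat.le_induction with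
  | base =>
    -- ===== base `K = j + 1`: the one-step chart at height `j` =====
    obtain ⟨Ω, T, T', θ, jac, M, s, Φ, J, ⟨hΩm, -, -, -, -, -, -, -, -, -, hΩS, -, -, -, -, -, -, -⟩, -, -,
      hΦm, hJm, -, -, -, -, -, -, -, havgΦ, hmap, hint₁, hJB, hmass⟩ := hjA j hj
    haveI : IsProbabilityMeasure (fieldMeasure (F.P (j + 1)) 0 ↥(Matrix.specialUnitaryGroup (Fin 2) ℂ)) := Missing.isProbabilityMeasure_fieldMeasure _ _
    have hSm : MeasurableSet {U : GaugeField (F.P (j + 1)) 0 ↥(Matrix.specialUnitaryGroup (Fin 2) ℂ) |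
        ∀ c, U (centralBond (bondShift (sitesPerDir_descend F j 0) c)) ∈ Ω c U} :=
      T4TriangularFibredChart.measurableSet_fineDomain (β := fun c : PBond (F.P j) 0 => centralBond (bondShift (sitesPerDir_descend F j 0) c)) Ω hΩm
    have hdesc : ∀ (h : j ≤ j + 1) (U : GaugeField (F.P (j + 1)) 0 ↥(Matrix.specialUnitaryGroup (Fin 2) ℂ)),
        descendTo F ℰp j (j + 1) h U = descend F ℰp j U := fun h U => (descend_eq_descendTo' F j h U).symm
    have hself : ∀ (h : j + 1 ≤ j + 1) (U : GaugeField (F.P (j + 1)) 0 ↥(Matrix.specialUnitaryGroup (Fin 2) ℂ)),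
        descendTo F ℰp (j + 1) (j + 1) h U = U := fun h U => descendTo_self F ℰp (j + 1) U
    refine ⟨GaugeField (F.P (j + 1)) 0 ↥(Matrix.specialUnitaryGroup (Fin 2) ℂ), inferInstance,
      fieldMeasure (F.P (j + 1)) 0 ↥(Matrix.specialUnitaryGroup (Fin 2) ℂ), Φ, J,
      {U | ∀ c, U (centralBond (bondShift (sitesPerDir_descend F j 0) c)) ∈ Ω c U}, (M : ℝ) ^ Fintype.card (PBond (F.P j) 0),
      inferInstance, hΦm, hJm, hSm, ?_, ?_, ?_, ?_, hJB, ?_⟩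
    · intro U hU
      have h0 := hU (j + 1) le_rfl le_rfl
      rw [hself] at h0
      exact hΩS U h0
    · intro V z
      rw [hdesc]
      exact havgΦ V z
    · intro A hA
      have e : (descendTo F ℰp j (j + 1) (Nat.le_of_succ_le le_rfl) :
          GaugeField (F.P (j + 1)) 0 ↥(Matrix.specialUnitaryGroup (Fin 2) ℂ) → GaugeField (F.P j) 0 ↥(Matrix.specialUnitaryGroup (Fin 2) ℂ)) = descend F ℰp j :=
        funext fun U => hdesc _ U
      rw [e]
      exact hmap A hA
    · -- (C1′): an `MW_{j,j+1}`-supported test function is supported in the top window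
      intro f hf hsupp z
      refine hint₁ f hf (fun U hU => ?_) z
      have h0 := hsupp U hU (j + 1) le_rfl le_rfl
      rw [hself] at h0
      exact h0
    · intro V hV
      have e : {z : GaugeField (F.P (j + 1)) 0 ↥(Matrix.specialUnitaryGroup (Fin 2) ℂ) | ∀ (n : ℕ) (hjn : j + 1 ≤ n) (hnK : n ≤ j + 1),
          PlaqSmall (24 / 25 * θBal F.L γ b₀ p₀ n) (descendTo F ℰp n (j + 1) hnK (Φ (V, z)))} =
          {z | PlaqSmall (24 / 25 * θBal F.L γ b₀ p₀ (j + 1)) (Φ (V, z))} := by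
        ext z
        simp only [Set.mem_setOf_eq]
        constructor
        · intro h
          have h0 := h (j + 1) le_rfl le_rfl
          rw [hself] at h0
          exact h0
        · intro h n hjn hnK
          obtain rfl : n = j + 1 := le_antisymm hnK hjn
          rw [hself]
          exact h
      rw [e]
      exact hmass V hV
  | succ K hjK IH =>
    -- ===== step `K → K + 1`: compose the chart of `descendTo j K` (IH) with the one-step chart at height `K` =====
    obtain ⟨Z, mZ, τ, Φ, J, S, B, hτ, hΦm, hJm, hSm, hS, havgΦ, hmap, hint, hJB, hmass⟩ := IH
    obtain ⟨Ω₂, T₂, T₂', θ₂, jac₂, M₂, s₂, Φ₂, J₂, ⟨hΩm₂, -, -, -, -, -, -, -, -, -, hΩS₂, -, -, -, -, -, -, -⟩, -, -,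
      hΦm₂, hJm₂, -, -, -, -, -, -, -, havgΦ₂, hmap₂, hint₂, hJB₂, hmass₂⟩ := hjA K (by omega)
    -- standing facts
    haveI : IsProbabilityMeasure (fieldMeasure (F.P j) 0 ↥(Matrix.specialUnitaryGroup (Fin 2) ℂ)) := Missing.isProbabilityMeasure_fieldMeasure _ _
    haveI : IsProbabilityMeasure (fieldMeasure (F.P K) 0 ↥(Matrix.specialUnitaryGroup (Fin 2) ℂ)) := Missing.isProbabilityMeasure_fieldMeasure _ _
    haveI : IsProbabilityMeasure (fieldMeasure (F.P (K + 1)) 0 ↥(Matrix.specialUnitaryGroup (Fin 2) ℂ)) := Missing.isProbabilityMeasure_fieldMeasure _ _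
    have hdK : Measurable (descendTo F ℰp j K (Nat.le_of_succ_le hjK) :
        GaugeField (F.P K) 0 ↥(Matrix.specialUnitaryGroup (Fin 2) ℂ) → GaugeField (F.P j) 0 ↥(Matrix.specialUnitaryGroup (Fin 2) ℂ)) :=
      measurable_descendTo F ℰp measurableE_ℰp _
    have hd₂ : Measurable (descend F ℰp K :
        GaugeField (F.P (K + 1)) 0 ↥(Matrix.specialUnitaryGroup (Fin 2) ℂ) → GaugeField (F.P K) 0 ↥(Matrix.specialUnitaryGroup (Fin 2) ℂ)) :=
      T3NestedUnitLaws.measurable_descend F ℰp measurableE_ℰp K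
    have hS₂m : MeasurableSet {U : GaugeField (F.P (K + 1)) 0 ↥(Matrix.specialUnitaryGroup (Fin 2) ℂ) |
        ∀ c, U (centralBond (bondShift (sitesPerDir_descend F K 0) c)) ∈ Ω₂ c U} :=
      T4TriangularFibredChart.measurableSet_fineDomain (β := fun c : PBond (F.P K) 0 => centralBond (bondShift (sitesPerDir_descend F K 0) c)) Ω₂ hΩm₂
    -- the descent algebra: one step is `D_{K,K+1}`, `D_{n,K} ∘ D_{K,K+1} = D_{n,K+1}`, `D_{K+1,K+1} = id`
    have hmid : ∀ (n : ℕ) (hnK : n ≤ K) (h : n ≤ K + 1) (U : GaugeField (F.P (K + 1)) 0 ↥(Matrix.specialUnitaryGroup (Fin 2) ℂ)),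
        descendTo F ℰp n (K + 1) h U = descendTo F ℰp n K hnK (descend F ℰp K U) := by
      intro n hnK h U
      rw [descend_eq_descendTo' F K (Nat.le_succ K) U, descendTo_descendTo]
    have htop : ∀ (h : K + 1 ≤ K + 1) (U : GaugeField (F.P (K + 1)) 0 ↥(Matrix.specialUnitaryGroup (Fin 2) ℂ)), descendTo F ℰp (K + 1) (K + 1) h U = U :=
      fun h U => descendTo_self F ℰp (K + 1) U
    -- the composite data
    refine ⟨Z × GaugeField (F.P (K + 1)) 0 ↥(Matrix.specialUnitaryGroup (Fin 2) ℂ), inferInstance,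
      τ.prod (fieldMeasure (F.P (K + 1)) 0 ↥(Matrix.specialUnitaryGroup (Fin 2) ℂ)),
      fun p => Φ₂ (Φ (p.1, p.2.1), p.2.2), fun p => J (p.1, p.2.1) * J₂ (Φ (p.1, p.2.1), p.2.2),
      descend F ℰp K ⁻¹' S ∩ {U | ∀ c, U (centralBond (bondShift (sitesPerDir_descend F K 0) c)) ∈ Ω₂ c U},
      B * (M₂ : ℝ) ^ Fintype.card (PBond (F.P K) 0),
      inferInstance, measurable_comp_chart hΦm hΦm₂, measurable_comp_jacobian hΦm hJm hJm₂, (hd₂ hSm).inter hS₂m, ?_, ?_, ?_, ?_,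
      jacobian_comp_le hJB hJB₂, ?_⟩
    · -- MW ⊆ fine set
      intro U hU
      refine ⟨?_, ?_⟩
      · -- the one-step average is in the fine set of `descendTo j K`, by the IH applied to the levels `n ≤ K`
        refine hS (descend F ℰp K U) fun n hjn hnK => ?_
        have h := hU n hjn (by omega)
        rw [hmid n hnK] at h
        exact h
      · -- the top field is in the one-step fine set (`n = K + 1`)
        have h := hU (K + 1) (by omega) le_rfl
        rw [htop] at h
        exact hΩS₂ U h
    · -- havgΦ
      intro V z
      show descendTo F ℰp j (K + 1) _ (Φ₂ (Φ (V, z.1), z.2)) = V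
      rw [hmid j (Nat.le_of_succ_le hjK), havgΦ₂, havgΦ]
    · -- hmap by composition
      intro A hA
      have h := hmap_comp (fieldMeasure (F.P j) 0 ↥(Matrix.specialUnitaryGroup (Fin 2) ℂ)) (fieldMeasure (F.P K) 0 ↥(Matrix.specialUnitaryGroup (Fin 2) ℂ))
        (fieldMeasure (F.P (K + 1)) 0 ↥(Matrix.specialUnitaryGroup (Fin 2) ℂ)) τ (fieldMeasure (F.P (K + 1)) 0 ↥(Matrix.specialUnitaryGroup (Fin 2) ℂ))
        hdK hΦm hJm hSm hΦm₂ hJm₂ hmap hmap₂ A hA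
      have e : (descendTo F ℰp j (K + 1) (Nat.le_of_succ_le (by omega)) :
          GaugeField (F.P (K + 1)) 0 ↥(Matrix.specialUnitaryGroup (Fin 2) ℂ) → GaugeField (F.P j) 0 ↥(Matrix.specialUnitaryGroup (Fin 2) ℂ)) =
          descendTo F ℰp j K (Nat.le_of_succ_le hjK) ∘ descend F ℰp K := funext fun U => hmid j _ _ U
      rw [e]
      exact h
    · -- (C1′) on MW: the level-`K` test function `y ↦ J₂ (y, U₂) · f (Φ₂ (y, U₂))` is continuous (one-step (C1′) on the `θ_K`-window, which contains
      -- the closure of its support ⊆ MW_{j,K}) and MW_{j,K}-supported (havgΦ₂), so the IH (C1′) applies to it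
      intro f hf hsupp z
      have hθK : 0 < θBal F.L γ b₀ p₀ K := T3MinimiserStabilityReduction.θBal_pos F.hL.2.le hγ hγ1 hb₀ p₀ K
      -- the top-window support of `f`
      have hftop : ∀ U, f U ≠ 0 → PlaqSmall (24 / 25 * θBal F.L γ b₀ p₀ (K + 1)) U := by
        intro U hU
        have h := hsupp U hU (K + 1) (by omega) le_rfl
        rw [htop] at h
        exact h
      set g : GaugeField (F.P K) 0 ↥(Matrix.specialUnitaryGroup (Fin 2) ℂ) → ℝ := fun y => (J₂ (y, z.2) : ℝ) * f (Φ₂ (y, z.2)) with hg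
      -- `g` is supported in MW_{j,K}
      have hgsupp : ∀ y, g y ≠ 0 → ∀ (n : ℕ) (hjn : j + 1 ≤ n) (hnK : n ≤ K), PlaqSmall (24 / 25 * θBal F.L γ b₀ p₀ n) (descendTo F ℰp n K hnK y) := by
        intro y hy n hjn hnK
        have hfy : f (Φ₂ (y, z.2)) ≠ 0 := fun h0 => hy (by rw [hg]; exact mul_eq_zero_of_right _ h0)
        have h := hsupp _ hfy n hjn (by omega)
        rw [hmid n hnK, havgΦ₂] at h
        exact h
      -- `g` is continuous: on the open `θ_K`-window by the one-step (C1′); its support's closure lies inside that window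
      have hWopen : IsOpen {y : GaugeField (F.P K) 0 ↥(Matrix.specialUnitaryGroup (Fin 2) ℂ) | PlaqSmall (θBal F.L γ b₀ p₀ K) y} := by
        haveI : BorelSpace (GaugeField (F.P K) 0 ↥(Matrix.specialUnitaryGroup (Fin 2) ℂ)) := T3OrbitAverage.instBorelSpaceGaugeField
        have e : {y : GaugeField (F.P K) 0 ↥(Matrix.specialUnitaryGroup (Fin 2) ℂ) | PlaqSmall (θBal F.L γ b₀ p₀ K) y} =
            ⋂ p : Plaq (F.P K) 0, {y | dist1 (GaugeField.plaqHol y p) < θBal F.L γ b₀ p₀ K} := by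
          ext y; simp only [PlaqSmall, Set.mem_setOf_eq, Set.mem_iInter]
        rw [e]
        exact isOpen_iInter_of_finite fun p => isOpen_lt (continuous_dist1_plaqHol p) continuous_const
      have hCclosed : IsClosed {y : GaugeField (F.P K) 0 ↥(Matrix.specialUnitaryGroup (Fin 2) ℂ) | ∀ p : Plaq (F.P K) 0,
          dist1 (GaugeField.plaqHol y p) ≤ 24 / 25 * θBal F.L γ b₀ p₀ K} := by
        have e : {y : GaugeField (F.P K) 0 ↥(Matrix.specialUnitaryGroup (Fin 2) ℂ) | ∀ p : Plaq (F.P K) 0, dist1 (GaugeField.plaqHol y p) ≤ 24 / 25 * θBal F.L γ b₀ p₀ K} =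
            ⋂ p : Plaq (F.P K) 0, {y | dist1 (GaugeField.plaqHol y p) ≤ 24 / 25 * θBal F.L γ b₀ p₀ K} := by
          ext y; simp only [Set.mem_setOf_eq, Set.mem_iInter]
        rw [e]
        exact isClosed_iInter fun p => isClosed_le (continuous_dist1_plaqHol p) continuous_const
      have hgc : Continuous g := by
        refine ContinuousOn.continuous_of_tsupport_subset (hint₂ f hf hftop z.2) hWopen ?_
        -- tsupport g ⊆ closure (MW_{j,K}) ⊆ {dist1 ≤ 24∕25·θ_K} ⊆ θ_K-window
        refine (closure_minimal (fun y hy => ?_) hCclosed).trans fun y hy p => (hy p).trans_lt (by nlinarith [hθK])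
        have h := hgsupp y (Function.mem_support.1 hy) K hjK le_rfl
        rw [descendTo_self] at h
        exact fun p => (h p).le
      -- the IH (C1′) for `g` at the fibre point `z.1` is the composite integrand
      have hIH := hint g hgc hgsupp z.1
      refine hIH.congr fun V _ => ?_
      show (((J (V, z.1) * J₂ (Φ (V, z.1), z.2) : ℝ≥0) : ℝ) * f (Φ₂ (Φ (V, z.1), z.2))) = (J (V, z.1) : ℝ) * g (Φ (V, z.1))
      rw [hg, NNReal.coe_mul, mul_assoc]
    · -- (C3) on MW, by Tonelli over the IH mass and the one-step mass at height `K`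
      intro V hV
      -- the IH slice, the top window, the composite slice
      set Mz : Set Z := {z | ∀ (n : ℕ) (hjn : j + 1 ≤ n) (hnK : n ≤ K), PlaqSmall (24 / 25 * θBal F.L γ b₀ p₀ n)
          (descendTo F ℰp n K hnK (Φ (V, z)))} with hMz
      set Wtop : Set (Z × GaugeField (F.P (K + 1)) 0 ↥(Matrix.specialUnitaryGroup (Fin 2) ℂ)) :=
          {p | PlaqSmall (24 / 25 * θBal F.L γ b₀ p₀ (K + 1)) (Φ₂ (Φ (V, p.1), p.2))} with hWtop
      set N : Set (Z × GaugeField (F.P (K + 1)) 0 ↥(Matrix.specialUnitaryGroup (Fin 2) ℂ)) := {p | ∀ (n : ℕ) (hjn : j + 1 ≤ n) (hnK : n ≤ K + 1),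
          PlaqSmall (24 / 25 * θBal F.L γ b₀ p₀ n) (descendTo F ℰp n (K + 1) hnK (Φ₂ (Φ (V, p.1), p.2)))} with hN
      set N' : Set (Z × GaugeField (F.P (K + 1)) 0 ↥(Matrix.specialUnitaryGroup (Fin 2) ℂ)) := {p | p.1 ∈ Mz ∧ p ∈ Wtop} with hN'
      -- `N' ⊆ N`: the intermediate conditions of the composite point are the IH conditions (havgΦ₂), the top one is the one-step window
      have hN'N : N' ⊆ N := by
        rintro ⟨z, U⟩ ⟨hz, hU⟩ n hjn hnK
        by_cases hn : n ≤ K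
        · have e : descendTo F ℰp n (K + 1) hnK (Φ₂ (Φ (V, z), U)) = descendTo F ℰp n K hn (Φ (V, z)) := by
            rw [hmid n hn, havgΦ₂]
          rw [e]; exact hz n hjn hn
        · obtain rfl : n = K + 1 := by omega
          rw [htop]
          exact hU
      -- measurability of windows and slices
      have hwin : ∀ (n : ℕ) (δ : ℝ), MeasurableSet {U : GaugeField (F.P n) 0 ↥(Matrix.specialUnitaryGroup (Fin 2) ℂ) | PlaqSmall δ U} := by
        intro n δ
        haveI : BorelSpace (GaugeField (F.P n) 0 ↥(Matrix.specialUnitaryGroup (Fin 2) ℂ)) := T3OrbitAverage.instBorelSpaceGaugeField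
        have e : {U : GaugeField (F.P n) 0 ↥(Matrix.specialUnitaryGroup (Fin 2) ℂ) | PlaqSmall δ U} = ⋂ p : Plaq (F.P n) 0, {U | dist1 (GaugeField.plaqHol U p) < δ} := by
          ext U; simp only [PlaqSmall, Set.mem_setOf_eq, Set.mem_iInter]
        rw [e]
        exact (isOpen_iInter_of_finite fun p => isOpen_lt (continuous_dist1_plaqHol p) continuous_const).measurableSet
      have hMzm : MeasurableSet Mz := by
        have e : Mz = ⋂ (n : ℕ) (hjn : j + 1 ≤ n) (hnK : n ≤ K), (fun z => descendTo F ℰp n K hnK (Φ (V, z))) ⁻¹'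
            {U | PlaqSmall (24 / 25 * θBal F.L γ b₀ p₀ n) U} := by
          ext z; simp only [hMz, Set.mem_setOf_eq, Set.mem_iInter, Set.mem_preimage]
        rw [e]
        exact MeasurableSet.iInter fun n => MeasurableSet.iInter fun hjn => MeasurableSet.iInter fun hnK =>
          ((measurable_descendTo F ℰp measurableE_ℰp hnK).comp (hΦm.comp measurable_prodMk_left)) (hwin _ _)
      have hΨm : Measurable fun p : Z × GaugeField (F.P (K + 1)) 0 ↥(Matrix.specialUnitaryGroup (Fin 2) ℂ) => Φ₂ (Φ (V, p.1), p.2) :=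
        hΦm₂.comp ((hΦm.comp (measurable_const.prodMk measurable_fst)).prodMk measurable_snd)
      have hWtopm : MeasurableSet Wtop := hΨm (hwin _ _)
      have hN'm : MeasurableSet N' := (measurable_fst hMzm).inter hWtopm
      -- the integrands
      set G : Z × GaugeField (F.P (K + 1)) 0 ↥(Matrix.specialUnitaryGroup (Fin 2) ℂ) → ℝ≥0∞ :=
        fun p => ((J (V, p.1) * J₂ (Φ (V, p.1), p.2) : ℝ≥0) : ℝ≥0∞) with hG
      have hJ₂Ψm : Measurable fun p : Z × GaugeField (F.P (K + 1)) 0 ↥(Matrix.specialUnitaryGroup (Fin 2) ℂ) => (J₂ (Φ (V, p.1), p.2) : ℝ≥0∞) :=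
        measurable_coe_nnreal_ennreal.comp (hJm₂.comp ((hΦm.comp (measurable_const.prodMk measurable_fst)).prodMk measurable_snd))
      have hJ1m : Measurable fun z : Z => (J (V, z) : ℝ≥0∞) := measurable_coe_nnreal_ennreal.comp (hJm.comp measurable_prodMk_left)
      have hGm : Measurable G :=
        measurable_coe_nnreal_ennreal.comp ((hJm.comp (measurable_const.prodMk measurable_fst)).mul
          (hJm₂.comp ((hΦm.comp (measurable_const.prodMk measurable_fst)).prodMk measurable_snd)))
      -- the inner one-step integrand at the intermediate datum `y = Φ (V, z)`
      set g₂ : Z × GaugeField (F.P (K + 1)) 0 ↥(Matrix.specialUnitaryGroup (Fin 2) ℂ) → ℝ≥0∞ := Wtop.indicator fun p => (J₂ (Φ (V, p.1), p.2) : ℝ≥0∞) with hg₂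
      have hg₂m : Measurable g₂ := hJ₂Ψm.indicator hWtopm
      have hI₂m : Measurable fun z => ∫⁻ U, g₂ (z, U) ∂(fieldMeasure (F.P (K + 1)) 0 ↥(Matrix.specialUnitaryGroup (Fin 2) ℂ)) := hg₂m.lintegral_prod_right'
      -- the inner integral is the one-step mass at `Φ (V, z)`, positive on the IH slice
      have hI₂pos : ∀ z ∈ Mz, 0 < ∫⁻ U, g₂ (z, U) ∂(fieldMeasure (F.P (K + 1)) 0 ↥(Matrix.specialUnitaryGroup (Fin 2) ℂ)) := by
        intro z hz
        have hy : PlaqSmall (θBal F.L γ b₀ p₀ K) (Φ (V, z)) := by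
          have h := hz K hjK le_rfl
          rw [descendTo_self] at h
          have hθ : 0 < θBal F.L γ b₀ p₀ K := T3MinimiserStabilityReduction.θBal_pos F.hL.2.le hγ hγ1 hb₀ p₀ K
          exact fun p => (h p).trans_le (by nlinarith [hθ])
        have h1 := hmass₂ (Φ (V, z)) hy
        have hsm : MeasurableSet {U : GaugeField (F.P (K + 1)) 0 ↥(Matrix.specialUnitaryGroup (Fin 2) ℂ) |
            PlaqSmall (24 / 25 * θBal F.L γ b₀ p₀ (K + 1)) (Φ₂ (Φ (V, z), U))} := hΦm₂.comp measurable_prodMk_left (hwin _ _)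
        rw [← lintegral_indicator hsm] at h1
        -- the two indicator integrands agree pointwise
        refine h1.trans_le (le_of_eq (lintegral_congr fun U => ?_))
        show {U : GaugeField (F.P (K + 1)) 0 ↥(Matrix.specialUnitaryGroup (Fin 2) ℂ) | PlaqSmall (24 / 25 * θBal F.L γ b₀ p₀ (K + 1)) (Φ₂ (Φ (V, z), U))}.indicator
            (fun U => (J₂ (Φ (V, z), U) : ℝ≥0∞)) U = Wtop.indicator (fun p => (J₂ (Φ (V, p.1), p.2) : ℝ≥0∞)) (z, U)
        by_cases hU : PlaqSmall (24 / 25 * θBal F.L γ b₀ p₀ (K + 1)) (Φ₂ (Φ (V, z), U))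
        · rw [indicator_of_mem (show U ∈ {U : GaugeField (F.P (K + 1)) 0 ↥(Matrix.specialUnitaryGroup (Fin 2) ℂ) |
              PlaqSmall (24 / 25 * θBal F.L γ b₀ p₀ (K + 1)) (Φ₂ (Φ (V, z), U))} from hU),
            indicator_of_mem (show (z, U) ∈ Wtop from hU)]
        · rw [indicator_of_notMem (show U ∉ {U : GaugeField (F.P (K + 1)) 0 ↥(Matrix.specialUnitaryGroup (Fin 2) ℂ) |
              PlaqSmall (24 / 25 * θBal F.L γ b₀ p₀ (K + 1)) (Φ₂ (Φ (V, z), U))} from hU),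
            indicator_of_notMem (show (z, U) ∉ Wtop from hU)]
      -- the `N'`-restricted composite integral, by Tonelli
      have hF'm : Measurable (N'.indicator G) := hGm.indicator hN'm
      have htonelli : ∫⁻ p, N'.indicator G p ∂(τ.prod (fieldMeasure (F.P (K + 1)) 0 ↥(Matrix.specialUnitaryGroup (Fin 2) ℂ))) =
          ∫⁻ z, Mz.indicator (fun z => (J (V, z) : ℝ≥0∞) * ∫⁻ U, g₂ (z, U) ∂(fieldMeasure (F.P (K + 1)) 0 ↥(Matrix.specialUnitaryGroup (Fin 2) ℂ))) z ∂τ := by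
        rw [lintegral_prod _ hF'm.aemeasurable]
        refine lintegral_congr fun z => ?_
        by_cases hz : z ∈ Mz
        · have hg₂z : Measurable fun U : GaugeField (F.P (K + 1)) 0 ↥(Matrix.specialUnitaryGroup (Fin 2) ℂ) => g₂ (z, U) := hg₂m.comp measurable_prodMk_left
          rw [indicator_of_mem hz, ← lintegral_const_mul _ hg₂z]
          refine lintegral_congr fun U => ?_
          by_cases hU : (z, U) ∈ Wtop
          · rw [indicator_of_mem (show (z, U) ∈ N' from ⟨hz, hU⟩)]
            show ((J (V, z) * J₂ (Φ (V, z), U) : ℝ≥0) : ℝ≥0∞) = (J (V, z) : ℝ≥0∞) * Wtop.indicator (fun p => (J₂ (Φ (V, p.1), p.2) : ℝ≥0∞)) (z, U)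
            rw [indicator_of_mem hU, ENNReal.coe_mul]
          · rw [indicator_of_notMem (show (z, U) ∉ N' from fun h => hU h.2)]
            show (0 : ℝ≥0∞) = (J (V, z) : ℝ≥0∞) * Wtop.indicator (fun p => (J₂ (Φ (V, p.1), p.2) : ℝ≥0∞)) (z, U)
            rw [indicator_of_notMem hU, mul_zero]
        · rw [indicator_of_notMem hz]
          refine (lintegral_congr fun U => ?_).trans lintegral_zero
          exact indicator_of_notMem (show (z, U) ∉ N' from fun h => hz h.1) _
      -- positivity of the outer integral: same support as the IH integrand
      have houter : 0 < ∫⁻ z, Mz.indicator (fun z => (J (V, z) : ℝ≥0∞) * ∫⁻ U, g₂ (z, U) ∂(fieldMeasure (F.P (K + 1)) 0 ↥(Matrix.specialUnitaryGroup (Fin 2) ℂ))) z ∂τ := by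
        have hIH : 0 < ∫⁻ z, Mz.indicator (fun z => (J (V, z) : ℝ≥0∞)) z ∂τ := by
          rw [lintegral_indicator hMzm]; exact hmass V hV
        refine lintegral_pos_of_support_subset (hJ1m.indicator hMzm) ((hJ1m.mul hI₂m).indicator hMzm) (fun z hz => ?_) hIH
        by_cases hzM : z ∈ Mz
        · rw [indicator_of_mem hzM] at hz ⊢
          exact mul_ne_zero hz (hI₂pos z hzM).ne'
        · rw [indicator_of_notMem hzM] at hz; exact absurd rfl hz
      -- assemble: `∫_N G ≥ ∫_{N'} G =` Tonelli `> 0`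
      calc (0 : ℝ≥0∞) < ∫⁻ p, N'.indicator G p ∂(τ.prod (fieldMeasure (F.P (K + 1)) 0 ↥(Matrix.specialUnitaryGroup (Fin 2) ℂ))) := by
            rw [htonelli]; exact houter
        _ = ∫⁻ p in N', G p ∂(τ.prod (fieldMeasure (F.P (K + 1)) 0 ↥(Matrix.specialUnitaryGroup (Fin 2) ℂ))) := lintegral_indicator hN'm _
        _ ≤ ∫⁻ p in N, G p ∂(τ.prod (fieldMeasure (F.P (K + 1)) 0 ↥(Matrix.specialUnitaryGroup (Fin 2) ℂ))) := lintegral_mono_set hN'N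

end Summit.QuantumFields.YangMills.Theorems.FluctuationComparisonRegPrIntLOrganTangentFibredChartDescendTo

end
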